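import Mathlib
import Summits.ValiantsHypothesis.ValiantsHypothesis.Theorems.ProofCarryingSymmetryRestorationQPConstNorm
import Summits.ValiantsHypothesis.ValiantsHypothesis.Theorems.ProofCarryingSymmetryRestorationQPACUnfoldSize

/-!
# Route ProofCarryingSymmetry — crux `RestorationQP`, line `registered`, rung S3⁗ under stub S2″ (`stub_proofsToACEquiv`), part 6:
size and subformulas of the constant-folding normal form; the gate budget

Continuation of `…RestorationQPConstNorm.lean` (`sadd`, `smul`, `cnorm`).  The bookkeeping that makes
the AC-canonical circuit of `cnormClass C = ⟦cnorm C•⟧` polynomial: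

* SIZE: `|cnorm F| + 2 ≤ 3|F|` (`size_cnorm_le`) — a smart sum/product adds at most two nodes;
* SUBFORMULAS: one smart sum `sadd a b` creates at most three new formulas — itself, the merged
  non-constant part `ainner a b` and the constant leaf `aconst a b` (`subs_sadd`); likewise `smul`;
  hence every subformula of `cnorm F` is `cnorm K`, `cinner K` or `cconst K` for a subformula `K` of
  `F` (`subs_cnorm_subset`), and `cnorm F` has at most three times as many distinct subformulas;
* for a Hrubeš–Tzameret circuit `C`: `cnormClass C`, its equivariance (`smul_cnormClass`, as `cnorm`
  commutes with renaming), its value `Ĉ` (`eval_cnormClass`), at most `3(|C| + 1)` reachable classes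
  (`card_reach_cnormClass_le`) with `< 2^(|C|+3)` children each (`card_kids_lt_of_mem_reach_cnormClass`).

Everything is elementary and proved; no named facts.
-/

-- single-problem summit: `Summit.ValiantsHypothesis.ValiantsHypothesis.…` is the namespace by design (D-0017)
set_option linter.dupNamespace false

noncomputable section

open scoped Classical

namespace Summit.ValiantsHypothesis.ValiantsHypothesis.Theorems

namespace ACStability

open Literature.Computability.AlgebraicComplexity ACClass

universe u v

variable {𝔽 : Type u} [CommSemiring 𝔽] {X : Type v}

/-! ### Size -/

/-- The non-constant summand is at most as large. [folklore] -/
theorem osize_asplit_le (a : PIFormula 𝔽 X) : osize (asplit a).1 ≤ a.size := by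
  cases a with
  | var x => simp [osize]
  | const c => simp [osize]
  | mul p q => simp [osize]
  | add p q =>
    cases q with
    | const c => simp only [asplit_add_const, osize, PIFormula.size_add, PIFormula.size_const]; omega
    | _ => simp [osize, asplit]

/-- The non-constant factor is at most as large. [folklore] -/
theorem osize_msplit_le (a : PIFormula 𝔽 X) : osize (msplit a).1 ≤ a.size := by
  cases a with
  | var x => simp [osize]
  | const c => simp [osize]
  | add p q => simp [osize]
  | mul p q =>
    cases q with
    | const c => simp only [msplit_mul_const, osize, PIFormula.size_mul, PIFormula.size_const]; omega
    | _ => simp [osize, msplit]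

/-- Size of a reassembled sum. [folklore] -/
theorem size_amk_le (m : Option (PIFormula 𝔽 X)) (c : 𝔽) : (amk m c).size ≤ osize m + 2 := by
  cases m with
  | none => simp [osize]
  | some p =>
    by_cases hc : c = 0
    · subst hc; simp [osize]
    · simp [amk_some_of_ne p hc, osize]

/-- Size of a reassembled product. [folklore] -/
theorem size_mmk_le (m : Option (PIFormula 𝔽 X)) (c : 𝔽) : (mmk m c).size ≤ osize m + 2 := by
  cases m with
  | none => simp [osize]
  | some p =>
    by_cases hc : c = 1
    · subst hc; simp [osize]
    · simp [mmk_some_of_ne p hc, osize]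

/-- Size of a smart sum. [folklore] -/
theorem size_sadd_le (a b : PIFormula 𝔽 X) : (sadd a b).size ≤ a.size + b.size + 3 := by
  have h1 := size_amk_le (amerge (asplit a).1 (asplit b).1) ((asplit a).2 + (asplit b).2)
  have h2 := osize_amerge_le (asplit a).1 (asplit b).1
  have h3 := osize_asplit_le a
  have h4 := osize_asplit_le b
  rw [sadd]
  omega

/-- Size of a smart product. [folklore] -/
theorem size_smul_le (a b : PIFormula 𝔽 X) : (smul a b).size ≤ a.size + b.size + 3 := by
  by_cases h : (msplit a).2 * (msplit b).2 = 0
  · rw [smul_of_eq_zero h]; simp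
  · have h1 := size_mmk_le (mmerge (msplit a).1 (msplit b).1) ((msplit a).2 * (msplit b).2)
    have h2 := osize_mmerge_le (msplit a).1 (msplit b).1
    have h3 := osize_msplit_le a
    have h4 := osize_msplit_le b
    rw [smul_of_ne_zero h]
    omega

/-- **Normalising at most triples the size**: `|cnorm F| + 2 ≤ 3 |F|`. [folklore] -/
theorem size_cnorm_le (F : PIFormula 𝔽 X) : (cnorm F).size + 2 ≤ 3 * F.size := by
  induction F with
  | var x => simp
  | const c => simp
  | add F G ihF ihG =>
    have := size_sadd_le (cnorm F) (cnorm G)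
    simp only [cnorm_add, PIFormula.size_add]
    omega
  | mul F G ihF ihG =>
    have := size_smul_le (cnorm F) (cnorm G)
    simp only [cnorm_mul, PIFormula.size_mul]
    omega

/-! ### Subformulas of smart sums and products -/

/-- The non-constant summand is a subformula. [folklore] -/
theorem mem_subs_of_asplit {a p : PIFormula 𝔽 X} (h : (asplit a).1 = some p) : p ∈ subs a := by
  cases a with
  | var x => simp at h; subst h; exact mem_subs_self _
  | const c => simp at h
  | mul q r => simp at h; subst h; exact mem_subs_self _
  | add q r =>
    cases r with
    | const c =>
      simp at h; subst h
      simp [subs, mem_subs_self]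
    | _ => simp [asplit] at h; subst h; exact mem_subs_self _

/-- The non-constant factor is a subformula. [folklore] -/
theorem mem_subs_of_msplit {a p : PIFormula 𝔽 X} (h : (msplit a).1 = some p) : p ∈ subs a := by
  cases a with
  | var x => simp at h; subst h; exact mem_subs_self _
  | const c => simp at h
  | add q r => simp at h; subst h; exact mem_subs_self _
  | mul q r =>
    cases r with
    | const c =>
      simp at h; subst h
      simp [subs, mem_subs_self]
    | _ => simp [msplit] at h; subst h; exact mem_subs_self _

/-- Subformulas of a reassembled sum. [folklore] -/
theorem subs_amk (m : Option (PIFormula 𝔽 X)) (c : 𝔽) : ∀ J ∈ subs (amk m c),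
    J = amk m c ∨ J = .const c ∨ ∃ p, m = some p ∧ J ∈ subs p := by
  intro J hJ
  cases m with
  | none => simp [subs] at hJ; exact Or.inr (Or.inl hJ)
  | some p =>
    by_cases hc : c = 0
    · subst hc
      rw [amk_some_zero] at hJ ⊢
      exact Or.inr (Or.inr ⟨p, rfl, hJ⟩)
    · rw [amk_some_of_ne p hc] at hJ ⊢
      simp only [subs, List.mem_cons, List.mem_append] at hJ
      rcases hJ with h | h | h
      · exact Or.inl h
      · exact Or.inr (Or.inr ⟨p, rfl, h⟩)
      · simp at h; exact Or.inr (Or.inl h)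

/-- Subformulas of a reassembled product. [folklore] -/
theorem subs_mmk (m : Option (PIFormula 𝔽 X)) (c : 𝔽) : ∀ J ∈ subs (mmk m c),
    J = mmk m c ∨ J = .const c ∨ ∃ p, m = some p ∧ J ∈ subs p := by
  intro J hJ
  cases m with
  | none => simp [subs] at hJ; exact Or.inr (Or.inl hJ)
  | some p =>
    by_cases hc : c = 1
    · subst hc
      rw [mmk_some_one] at hJ ⊢
      exact Or.inr (Or.inr ⟨p, rfl, hJ⟩)
    · rw [mmk_some_of_ne p hc] at hJ ⊢
      simp only [subs, List.mem_cons, List.mem_append] at hJ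
      rcases hJ with h | h | h
      · exact Or.inl h
      · exact Or.inr (Or.inr ⟨p, rfl, h⟩)
      · simp at h; exact Or.inr (Or.inl h)

omit [CommSemiring 𝔽] in
/-- Subformulas of a merge. [folklore] -/
theorem subs_amerge {x y : Option (PIFormula 𝔽 X)} {p : PIFormula 𝔽 X} (h : amerge x y = some p) :
    ∀ J ∈ subs p, J = p ∨ (∃ q, x = some q ∧ J ∈ subs q) ∨ (∃ q, y = some q ∧ J ∈ subs q) := by
  intro J hJ
  cases x with
  | none => simp at h; subst h; exact Or.inr (Or.inr ⟨_, rfl, hJ⟩)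
  | some q =>
    cases y with
    | none => simp at h; subst h; exact Or.inr (Or.inl ⟨_, rfl, hJ⟩)
    | some r =>
      simp at h; subst h
      simp only [subs, List.mem_cons, List.mem_append] at hJ
      rcases hJ with h | h | h
      · exact Or.inl h
      · exact Or.inr (Or.inl ⟨q, rfl, h⟩)
      · exact Or.inr (Or.inr ⟨r, rfl, h⟩)

omit [CommSemiring 𝔽] in
/-- Subformulas of a merge. [folklore] -/
theorem subs_mmerge {x y : Option (PIFormula 𝔽 X)} {p : PIFormula 𝔽 X} (h : mmerge x y = some p) :
    ∀ J ∈ subs p, J = p ∨ (∃ q, x = some q ∧ J ∈ subs q) ∨ (∃ q, y = some q ∧ J ∈ subs q) := by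
  intro J hJ
  cases x with
  | none => simp at h; subst h; exact Or.inr (Or.inr ⟨_, rfl, hJ⟩)
  | some q =>
    cases y with
    | none => simp at h; subst h; exact Or.inr (Or.inl ⟨_, rfl, hJ⟩)
    | some r =>
      simp at h; subst h
      simp only [subs, List.mem_cons, List.mem_append] at hJ
      rcases hJ with h | h | h
      · exact Or.inl h
      · exact Or.inr (Or.inl ⟨q, rfl, h⟩)
      · exact Or.inr (Or.inr ⟨r, rfl, h⟩)

/-- The merged non-constant part created by a smart sum (a dummy leaf if there is none).
[folklore] -/
def ainner (a b : PIFormula 𝔽 X) : PIFormula 𝔽 X := (amerge (asplit a).1 (asplit b).1).getD (.const 0)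

/-- The constant leaf created by a smart sum. [folklore] -/
def aconst (a b : PIFormula 𝔽 X) : PIFormula 𝔽 X := .const ((asplit a).2 + (asplit b).2)

/-- The merged non-constant part created by a smart product (a dummy leaf if there is none).
[folklore] -/
def minner (a b : PIFormula 𝔽 X) : PIFormula 𝔽 X := (mmerge (msplit a).1 (msplit b).1).getD (.const 0)

/-- The constant leaf created by a smart product. [folklore] -/
def mconst (a b : PIFormula 𝔽 X) : PIFormula 𝔽 X := .const ((msplit a).2 * (msplit b).2)

/-- **Subformulas of a smart sum**: itself, the merged part, the constant leaf, or subformulas of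
the arguments. [folklore] -/
theorem subs_sadd (a b : PIFormula 𝔽 X) : ∀ J ∈ subs (sadd a b),
    J = sadd a b ∨ J = ainner a b ∨ J = aconst a b ∨ J ∈ subs a ∨ J ∈ subs b := by
  intro J hJ
  rcases subs_amk _ _ J hJ with h | h | ⟨p, hp, hJp⟩
  · exact Or.inl h
  · exact Or.inr (Or.inr (Or.inl h))
  · rcases subs_amerge hp J hJp with h | ⟨q, hq, hJq⟩ | ⟨q, hq, hJq⟩
    · refine Or.inr (Or.inl ?_)
      rw [ainner, hp]; exact h
    · exact Or.inr (Or.inr (Or.inr (Or.inl (subs_subset_of_mem (mem_subs_of_asplit hq) hJq))))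
    · exact Or.inr (Or.inr (Or.inr (Or.inr (subs_subset_of_mem (mem_subs_of_asplit hq) hJq))))

/-- **Subformulas of a smart product.** [folklore] -/
theorem subs_smul (a b : PIFormula 𝔽 X) : ∀ J ∈ subs (smul a b),
    J = smul a b ∨ J = minner a b ∨ J = mconst a b ∨ J ∈ subs a ∨ J ∈ subs b := by
  intro J hJ
  by_cases h0 : (msplit a).2 * (msplit b).2 = 0
  · rw [smul_of_eq_zero h0] at hJ
    simp [subs] at hJ
    refine Or.inr (Or.inr (Or.inl ?_))
    rw [hJ, mconst, h0]
  · rw [smul_of_ne_zero h0] at hJ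
    rcases subs_mmk _ _ J hJ with h | h | ⟨p, hp, hJp⟩
    · rw [← smul_of_ne_zero h0] at h; exact Or.inl h
    · exact Or.inr (Or.inr (Or.inl h))
    · rcases subs_mmerge hp J hJp with h | ⟨q, hq, hJq⟩ | ⟨q, hq, hJq⟩
      · refine Or.inr (Or.inl ?_)
        rw [minner, hp]; exact h
      · exact Or.inr (Or.inr (Or.inr (Or.inl (subs_subset_of_mem (mem_subs_of_msplit hq) hJq))))
      · exact Or.inr (Or.inr (Or.inr (Or.inr (subs_subset_of_mem (mem_subs_of_msplit hq) hJq))))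

/-- The new inner node attached to a node of the original formula. [folklore] -/
def cinner : PIFormula 𝔽 X → PIFormula 𝔽 X
  | .add F G => ainner (cnorm F) (cnorm G)
  | .mul F G => minner (cnorm F) (cnorm G)
  | F => F

/-- The new constant leaf attached to a node of the original formula. [folklore] -/
def cconst : PIFormula 𝔽 X → PIFormula 𝔽 X
  | .add F G => aconst (cnorm F) (cnorm G)
  | .mul F G => mconst (cnorm F) (cnorm G)
  | F => F

/-- **Subformula control**: every subformula of `cnorm F` is `cnorm K`, `cinner K` or `cconst K` for
a subformula `K` of `F`. [folklore] -/
theorem subs_cnorm_subset (F : PIFormula 𝔽 X) :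
    ∀ J ∈ subs (cnorm F), ∃ K ∈ subs F, J = cnorm K ∨ J = cinner K ∨ J = cconst K := by
  induction F with
  | var x => intro J hJ; simp [subs] at hJ; exact ⟨.var x, mem_subs_self _, Or.inl (by rw [hJ]; rfl)⟩
  | const c => intro J hJ; simp [subs] at hJ; exact ⟨.const c, mem_subs_self _, Or.inl (by rw [hJ]; rfl)⟩
  | add F G ihF ihG =>
    intro J hJ
    rw [cnorm_add] at hJ
    rcases subs_sadd _ _ J hJ with h | h | h | h | h
    · exact ⟨.add F G, mem_subs_self _, Or.inl h⟩
    · exact ⟨.add F G, mem_subs_self _, Or.inr (Or.inl h)⟩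
    · exact ⟨.add F G, mem_subs_self _, Or.inr (Or.inr h)⟩
    · obtain ⟨K, hK, hJ⟩ := ihF J h
      exact ⟨K, by simp only [subs, List.mem_cons, List.mem_append]; exact Or.inr (Or.inl hK), hJ⟩
    · obtain ⟨K, hK, hJ⟩ := ihG J h
      exact ⟨K, by simp only [subs, List.mem_cons, List.mem_append]; exact Or.inr (Or.inr hK), hJ⟩
  | mul F G ihF ihG =>
    intro J hJ
    rw [cnorm_mul] at hJ
    rcases subs_smul _ _ J hJ with h | h | h | h | h
    · exact ⟨.mul F G, mem_subs_self _, Or.inl h⟩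
    · exact ⟨.mul F G, mem_subs_self _, Or.inr (Or.inl h)⟩
    · exact ⟨.mul F G, mem_subs_self _, Or.inr (Or.inr h)⟩
    · obtain ⟨K, hK, hJ⟩ := ihF J h
      exact ⟨K, by simp only [subs, List.mem_cons, List.mem_append]; exact Or.inr (Or.inl hK), hJ⟩
    · obtain ⟨K, hK, hJ⟩ := ihG J h
      exact ⟨K, by simp only [subs, List.mem_cons, List.mem_append]; exact Or.inr (Or.inr hK), hJ⟩

/-- `cnorm F` has at most three times as many distinct subformulas as `F`. [folklore] -/
theorem card_subs_cnorm_le (F : PIFormula 𝔽 X) :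
    (subs (cnorm F)).toFinset.card ≤ 3 * (subs F).toFinset.card := by
  set S := (subs F).toFinset with hS
  have hsub : (subs (cnorm F)).toFinset ⊆ S.image cnorm ∪ S.image cinner ∪ S.image cconst := by
    intro J hJ
    obtain ⟨K, hK, h⟩ := subs_cnorm_subset F J (List.mem_toFinset.1 hJ)
    have hKS : K ∈ S := List.mem_toFinset.2 hK
    rcases h with rfl | rfl | rfl
    · exact Finset.mem_union_left _ (Finset.mem_union_left _ (Finset.mem_image_of_mem _ hKS))
    · exact Finset.mem_union_left _ (Finset.mem_union_right _ (Finset.mem_image_of_mem _ hKS))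
    · exact Finset.mem_union_right _ (Finset.mem_image_of_mem _ hKS)
  calc (subs (cnorm F)).toFinset.card ≤ (S.image cnorm ∪ S.image cinner ∪ S.image cconst).card :=
        Finset.card_le_card hsub
    _ ≤ (S.image cnorm).card + (S.image cinner).card + (S.image cconst).card :=
        (Finset.card_union_le _ _).trans (Nat.add_le_add_right (Finset.card_union_le _ _) _)
    _ ≤ S.card + S.card + S.card :=
        Nat.add_le_add (Nat.add_le_add Finset.card_image_le Finset.card_image_le) Finset.card_image_le
    _ = 3 * S.card := by ring

/-! ### The constant-normal class of a circuit -/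

/-- The AC-class of the constant-folding normal form of the unfolding of a circuit. [folklore] -/
def cnormClass (C : PICircuit 𝔽 X) : ACClass 𝔽 X := ACClass.mk (cnorm C.unfold)

/-- Translating the constant-normal class is renaming the circuit. [folklore] -/
theorem smul_cnormClass {Γ : Type*} [Group Γ] [MulAction Γ X] (γ : Γ) (C : PICircuit 𝔽 X) :
    γ • cnormClass C = cnormClass (C.rename fun x => γ • x) := by
  simp only [cnormClass, smul_mk, PICircuit.unfold_rename, cnorm_rename]

/-- The constant-normal class computes `Ĉ`. [folklore] -/
theorem eval_cnormClass (C : PICircuit 𝔽 X) : (cnormClass C).eval = C.eval := by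
  simp only [cnormClass, eval_mk, eval_cnorm]
  rfl

/-- **Gate budget**: at most `3(|C| + 1)` classes are reachable from the constant-normal class.
[folklore] -/
theorem card_reach_cnormClass_le (C : PICircuit 𝔽 X) : (reach (cnormClass C)).card ≤ 3 * (C.size + 1) :=
  calc (reach (cnormClass C)).card ≤ ((subs (cnorm C.unfold)).toFinset.image mk).card :=
        Finset.card_le_card (reach_mk_subset _)
    _ ≤ (subs (cnorm C.unfold)).toFinset.card := Finset.card_image_le
    _ ≤ 3 * (subs C.unfold).toFinset.card := card_subs_cnorm_le _
    _ ≤ 3 * (C.size + 1) := Nat.mul_le_mul_left 3 (card_subs_unfold_le C)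

/-- **Multiplicity bound**: a class reachable from the constant-normal class has `< 2 ^ (|C| + 3)`
children (with multiplicity). [folklore] -/
theorem card_kids_lt_of_mem_reach_cnormClass {C : PICircuit 𝔽 X} {q : ACClass 𝔽 X}
    (hq : q ∈ reach (cnormClass C)) : Multiset.card q.kids < 2 ^ (C.size + 3) := by
  obtain ⟨K, hK, rfl⟩ := exists_mem_subs_of_reaches (mem_reach.1 hq)
  have h1 : (ACStability.kids K).length < K.size := length_kids_lt_size K
  have h2 : K.size ≤ (cnorm C.unfold).size := size_le_of_mem_subs hK
  have h3 := size_cnorm_le C.unfold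
  have h4 := size_unfold_lt C
  have h5 : 2 ^ (C.size + 3) = 4 * 2 ^ (C.size + 1) := by ring
  simp only [kids_mk, Multiset.coe_card, List.length_map]
  omega

end ACStability

open Literature.Computability.AlgebraicComplexity in
/-- **Gate budget of the constant-folding normal form** (helper under stub S2″ `stub_proofsToACEquiv`,
crux `RestorationQP`, rung S3⁗): at most `3(|C| + 1)` AC-classes are reachable from the class of the
constant-folding normal form of the unfolding of a Hrubeš–Tzameret circuit `C` over `ℂ`, each with
fewer than `2^(|C|+3)` children. [folklore] -/
theorem proofsToACEquiv_aux_constNormBudget : ∀ (n : ℕ) (C : PICircuit ℂ (Fin n × Fin n)), (ACStability.ACClass.reach (ACStability.cnormClass C)).card ≤ 3 * (C.size + 1) ∧ ∀ q ∈ ACStability.ACClass.reach (ACStability.cnormClass C), Multiset.card q.kids < 2 ^ (C.size + 3) := by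
  intro n C
  exact ⟨ACStability.card_reach_cnormClass_le C, fun _ hq => ACStability.card_kids_lt_of_mem_reach_cnormClass hq⟩

end Summit.ValiantsHypothesis.ValiantsHypothesis.Theorems

end
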